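import Summits.Ventures.HodgeRepro2.T5RecordLatticeModelOutsideDiscriminant
import Summits.Ventures.HodgeRepro2.T5RecordSatakeCyclotomicDiscriminant
import Summits.Ventures.HodgeRepro2.T5CyclotomicSevenInertThree
import Summits.Ventures.HodgeRepro2.T5RecordSatakeInertToy

/-!
# The lattice-model data of the record on `ℚ(ζ₇)` and `ℚ(i)` at the inert place `(3)`, and outside `7` / `2`

Tier-5 support N3 / §G-N4.2 (seat p3, gen 86). File 331 states the lattice-model side of §N3.10.3 in one theorem at
every place `v` of `K⁺` with `disc K ∉ v`: an additive character `ψ` of conductor exponent `0` on `ℚ_p` exists with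
`n(ψ ∘ Tr) = 0`; for every such `ψ` and every `w ∣ v`: `e(w/v) = 1`, `n(ψ_w) = 0`, `𝒪_w` is `ψ_w`-self-dual, the
standard lattice `𝒪_w^n` is `ψ_w`-self-dual for `H_w = M.map ι` (any star preserving integrality), and
`𝒪_w^n × 𝒪_w^n` is self-dual for the split pair. This file inhabits its hypotheses on the two toy fields of the lane:

* **`record_lattice_model_seven_outside_seven`** — the field of record `ℚ(ζ₇)` at every place `v` of `ℚ(ζ₇)⁺` with
  `7 ∉ v` (file 327's `discr_seven_notMem`: `disc ℚ(ζ₇) = −7⁵ ∉ v`);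
* `seven_notMem_vThreeSeven`, `liesOver_vThreeSeven_vThree`, **`record_lattice_model_seven_three`** — at the
  concrete inert place `(3)` of `ℚ(ζ₇)⁺` (file 253), above the place `(3)` of `ℚ` (seat p8's `vThree`), for every
  `M ∈ GL(𝓞_{ℚ(ζ₇)})`, and `record_lattice_model_seven_three_diagonal` for `M = diag(1, 1, −1)`;
* `discr_four_notMem`, **`record_lattice_model_four_outside_two`**, `two_notMem_vThreePlus`,
  `liesOver_vThreePlus_vThree`, **`record_lattice_model_four_three`** — the same on `ℚ(i)` (`disc ℚ(i) = −4`,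
  file 323) at every place with `2 ∉ v` and at `(3)` (file 238's `vThreePlus`).

§8(d): uses an L-value-free non-vanishing device: NO.
-/

open IsDedekindDomain IsDedekindDomain.HeightOneSpectrum NumberField Matrix
open Summit.Ventures.HodgeRepro2.T5AdditiveConductor Summit.Ventures.HodgeRepro2.T5UnitaryGroupIsometry
  Summit.Ventures.HodgeRepro2.T5ConductorDualBall Summit.Ventures.HodgeRepro2.T5ConductorDualLattice
  Summit.Ventures.HodgeRepro2.T5ConductorDualLatticeSplit Summit.Ventures.HodgeRepro2.T5ConductorZeroCharacter
  Summit.Ventures.HodgeRepro2.T5GlobalLatticeAlmostAll Summit.Ventures.HodgeRepro2.T5SplitHermitianClass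
  Summit.Ventures.HodgeRepro2.T5IntegralGramBadSet Summit.Ventures.HodgeRepro2.T5RecordLatticeModelOutsideDiscriminant
  Summit.Ventures.HodgeRepro2.T5RecordSatakeCyclotomicDiscriminant Summit.Ventures.HodgeRepro2.T5CyclotomicSevenInertThree
  Summit.Ventures.HodgeRepro2.T5RecordSatakeInertToy

namespace Summit.Ventures.HodgeRepro2.T5RecordLatticeModelSeven

/-- `3 ∈ vThree` (the place `(3)` of `ℚ`, seat p8's `T5InertPrimeToy.vThree`). -/
theorem three_mem_vThree : (3 : 𝓞 ℚ) ∈ T5InertPrimeToy.vThree.asIdeal :=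
  Ideal.mem_span_singleton_self 3

section Seven

variable (K : Type*) [Field K] [CharZero K] [IsCyclotomicExtension {7} ℚ K] [NumberField K]
variable {ι : Type*} [Fintype ι] [DecidableEq ι]

/-- **THE LATTICE-MODEL DATA OF THE RECORD ON THE FIELD OF RECORD `ℚ(ζ₇)` AT EVERY PLACE WITH `7 ∉ v`** (file 331
with `disc ℚ(ζ₇) = −7⁵ ∉ v`, file 327's `discr_seven_notMem`): for every `M ∈ GL(𝓞_{ℚ(ζ₇)})`, every place `vp` of
`ℚ` and every place `v` of `ℚ(ζ₇)⁺` above it with `7 ∉ v` — the four clauses (i)–(iv) of file 331. -/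
theorem record_lattice_model_seven_outside_seven (M : Matrix ι ι (𝓞 K)) (hM : IsUnit M.det)
    (vp : HeightOneSpectrum (𝓞 ℚ)) (v : HeightOneSpectrum (𝓞 (maximalRealSubfield K)))
    [v.asIdeal.LiesOver vp.asIdeal] (h7 : (7 : 𝓞 (maximalRealSubfield K)) ∉ v.asIdeal) :
    (∃ ψ : AddChar (vp.adicCompletion ℚ) Circle, Continuous ψ ∧ (∃ y, ψ y ≠ 1) ∧
      conductorExp ψ (Valued.v : Valuation (vp.adicCompletion ℚ) (WithZero (Multiplicative ℤ))) = 0 ∧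
      conductorExp (ψ.compAddMonoidHom
        (Algebra.trace (vp.adicCompletion ℚ) (v.adicCompletion (maximalRealSubfield K))).toAddMonoidHom)
        (Valued.v : Valuation (v.adicCompletion (maximalRealSubfield K)) (WithZero (Multiplicative ℤ))) = 0) ∧
    ∀ (ψ : AddChar (vp.adicCompletion ℚ) Circle), Continuous ψ → (∃ y, ψ y ≠ 1) →
      conductorExp ψ (Valued.v : Valuation (vp.adicCompletion ℚ) (WithZero (Multiplicative ℤ))) = 0 →
      ∀ (w : HeightOneSpectrum (𝓞 K)) [w.asIdeal.LiesOver v.asIdeal],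
        v.asIdeal.ramificationIdx' w.asIdeal = 1 ∧
        conductorExp (recordChar K vp v w ψ)
          (Valued.v : Valuation (w.adicCompletion K) (WithZero (Multiplicative ℤ))) = 0 ∧
        (∀ x : w.adicCompletion K,
          (∀ y : w.adicCompletion K, Valued.v y ≤ 1 → recordChar K vp v w ψ (x * y) = 1) ↔ Valued.v x ≤ 1) ∧
        (∀ [StarRing (w.adicCompletion K)],
          (∀ z : w.adicCompletion K, IsLocalization.IsInteger (w.adicCompletionIntegers K) z →
            IsLocalization.IsInteger (w.adicCompletionIntegers K) (star z)) →
          ∀ x : ι → w.adicCompletion K,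
            (∀ y ∈ stdLattice (w.adicCompletionIntegers K),
              recordChar K vp v w ψ
                (sesqForm (((algebraMap (𝓞 K) K).mapMatrix M).map (algebraMap K (w.adicCompletion K))) x y) = 1) ↔
              x ∈ stdLattice (w.adicCompletionIntegers K)) ∧
        (letI := swapStarRing (w.adicCompletion K)
          ∀ x : ι → w.adicCompletion K × w.adicCompletion K,
            (∀ y : ι → w.adicCompletion K × w.adicCompletion K,
              (∀ i, Valued.v (y i).1 ≤ 1 ∧ Valued.v (y i).2 ≤ 1) →
              recordChar K vp v w ψ
                  (sesqForm (pairMatrix (((algebraMap (𝓞 K) K).mapMatrix M).map (algebraMap K (w.adicCompletion K)))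
                    (((algebraMap (𝓞 K) K).mapMatrix M).map (algebraMap K (w.adicCompletion K)))ᵀ) x y).1 *
                recordChar K vp v w ψ
                  (sesqForm (pairMatrix (((algebraMap (𝓞 K) K).mapMatrix M).map (algebraMap K (w.adicCompletion K)))
                    (((algebraMap (𝓞 K) K).mapMatrix M).map (algebraMap K (w.adicCompletion K)))ᵀ) x y).2 = 1) ↔
              ∀ i, Valued.v (x i).1 ≤ 1 ∧ Valued.v (x i).2 ≤ 1) :=
  record_lattice_model_outside_discriminant K M hM v (discr_seven_notMem K v h7) vp

omit [NumberField K] in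
/-- `7 ∉ vThreeSeven`: with `3 ∈ vThreeSeven`, `7 ∈ vThreeSeven` would give `1 = 7 − 2 · 3 ∈ vThreeSeven`. -/
theorem seven_notMem_vThreeSeven : (7 : 𝓞 (maximalRealSubfield K)) ∉ (vThreeSeven K).asIdeal := by
  intro h7
  have h1 : (1 : 𝓞 (maximalRealSubfield K)) ∈ (vThreeSeven K).asIdeal := by
    have h := Ideal.sub_mem _ h7 (Ideal.mul_mem_left _ 2 (three_mem_vThreeSeven K))
    norm_num at h
    exact h
  exact (vThreeSeven K).isPrime.ne_top ((Ideal.eq_top_iff_one _).mpr h1)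

omit [NumberField K] in
/-- The place `(3)` of `ℚ(ζ₇)⁺` (file 253's `vThreeSeven`) lies over the place `(3)` of `ℚ`: `vThree = (3)` is
maximal in `𝓞_ℚ` and contained in the contraction of `vThreeSeven`. -/
instance liesOver_vThreeSeven_vThree : (vThreeSeven K).asIdeal.LiesOver T5InertPrimeToy.vThree.asIdeal := by
  refine ⟨?_⟩
  have hle : T5InertPrimeToy.vThree.asIdeal ≤ (vThreeSeven K).asIdeal.under (𝓞 ℚ) := by
    show Ideal.span {3} ≤ _
    rw [Ideal.span_le, Set.singleton_subset_iff, SetLike.mem_coe, Ideal.mem_under, map_ofNat]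
    exact three_mem_vThreeSeven K
  exact (T5InertPrimeToy.vThree.isPrime.isMaximal T5InertPrimeToy.vThree.ne_bot).eq_of_le
    (Ideal.IsPrime.comap _).ne_top hle

/-- **THE LATTICE-MODEL DATA ON `ℚ(ζ₇)` AT THE INERT PLACE `(3)`** (the place of files 253 / 347, `N(v) = 27`):
file 331's four clauses with `vp = (3)`, `v = vThreeSeven`, for every `M ∈ GL(𝓞_{ℚ(ζ₇)})`. -/
theorem record_lattice_model_seven_three (M : Matrix ι ι (𝓞 K)) (hM : IsUnit M.det) :
    (∃ ψ : AddChar ((T5InertPrimeToy.vThree).adicCompletion ℚ) Circle, Continuous ψ ∧ (∃ y, ψ y ≠ 1) ∧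
      conductorExp ψ (Valued.v : Valuation ((T5InertPrimeToy.vThree).adicCompletion ℚ) (WithZero (Multiplicative ℤ))) = 0 ∧
      conductorExp (ψ.compAddMonoidHom
        (Algebra.trace ((T5InertPrimeToy.vThree).adicCompletion ℚ) ((vThreeSeven K).adicCompletion (maximalRealSubfield K))).toAddMonoidHom)
        (Valued.v : Valuation ((vThreeSeven K).adicCompletion (maximalRealSubfield K)) (WithZero (Multiplicative ℤ))) = 0) ∧
    ∀ (ψ : AddChar ((T5InertPrimeToy.vThree).adicCompletion ℚ) Circle), Continuous ψ → (∃ y, ψ y ≠ 1) →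
      conductorExp ψ (Valued.v : Valuation ((T5InertPrimeToy.vThree).adicCompletion ℚ) (WithZero (Multiplicative ℤ))) = 0 →
      ∀ (w : HeightOneSpectrum (𝓞 K)) [w.asIdeal.LiesOver (vThreeSeven K).asIdeal],
        (vThreeSeven K).asIdeal.ramificationIdx' w.asIdeal = 1 ∧
        conductorExp (recordChar K (T5InertPrimeToy.vThree) (vThreeSeven K) w ψ)
          (Valued.v : Valuation (w.adicCompletion K) (WithZero (Multiplicative ℤ))) = 0 ∧
        (∀ x : w.adicCompletion K,
          (∀ y : w.adicCompletion K, Valued.v y ≤ 1 → recordChar K (T5InertPrimeToy.vThree) (vThreeSeven K) w ψ (x * y) = 1) ↔ Valued.v x ≤ 1) ∧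
        (∀ [StarRing (w.adicCompletion K)],
          (∀ z : w.adicCompletion K, IsLocalization.IsInteger (w.adicCompletionIntegers K) z →
            IsLocalization.IsInteger (w.adicCompletionIntegers K) (star z)) →
          ∀ x : ι → w.adicCompletion K,
            (∀ y ∈ stdLattice (w.adicCompletionIntegers K),
              recordChar K (T5InertPrimeToy.vThree) (vThreeSeven K) w ψ
                (sesqForm (((algebraMap (𝓞 K) K).mapMatrix M).map (algebraMap K (w.adicCompletion K))) x y) = 1) ↔
              x ∈ stdLattice (w.adicCompletionIntegers K)) ∧
        (letI := swapStarRing (w.adicCompletion K)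
          ∀ x : ι → w.adicCompletion K × w.adicCompletion K,
            (∀ y : ι → w.adicCompletion K × w.adicCompletion K,
              (∀ i, Valued.v (y i).1 ≤ 1 ∧ Valued.v (y i).2 ≤ 1) →
              recordChar K (T5InertPrimeToy.vThree) (vThreeSeven K) w ψ
                  (sesqForm (pairMatrix (((algebraMap (𝓞 K) K).mapMatrix M).map (algebraMap K (w.adicCompletion K)))
                    (((algebraMap (𝓞 K) K).mapMatrix M).map (algebraMap K (w.adicCompletion K)))ᵀ) x y).1 *
                recordChar K (T5InertPrimeToy.vThree) (vThreeSeven K) w ψ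
                  (sesqForm (pairMatrix (((algebraMap (𝓞 K) K).mapMatrix M).map (algebraMap K (w.adicCompletion K)))
                    (((algebraMap (𝓞 K) K).mapMatrix M).map (algebraMap K (w.adicCompletion K)))ᵀ) x y).2 = 1) ↔
              ∀ i, Valued.v (x i).1 ≤ 1 ∧ Valued.v (x i).2 ≤ 1) :=
  record_lattice_model_seven_outside_seven K M hM T5InertPrimeToy.vThree (vThreeSeven K)
    (seven_notMem_vThreeSeven K)

omit [CharZero K] [IsCyclotomicExtension {7} ℚ K] [NumberField K] in
/-- `det (diag(1, 1, −1)) = −1` is a unit of `𝓞_K`. -/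
theorem isUnit_det_diagonal : IsUnit (Matrix.diagonal ![1, 1, -1] : Matrix (Fin 3) (Fin 3) (𝓞 K)).det := by
  rw [det_diagonal, Fin.prod_univ_three]
  simp

/-- **THE LATTICE-MODEL DATA ON `ℚ(ζ₇)` AT `(3)` FOR `M = diag(1, 1, −1)`** — the integral Gram matrix of the lane's
`H₀` (file 237): every hypothesis of file 331 inhabited on the field of record at a concrete inert place. -/
theorem record_lattice_model_seven_three_diagonal :
    (∃ ψ : AddChar ((T5InertPrimeToy.vThree).adicCompletion ℚ) Circle, Continuous ψ ∧ (∃ y, ψ y ≠ 1) ∧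
      conductorExp ψ (Valued.v : Valuation ((T5InertPrimeToy.vThree).adicCompletion ℚ) (WithZero (Multiplicative ℤ))) = 0 ∧
      conductorExp (ψ.compAddMonoidHom
        (Algebra.trace ((T5InertPrimeToy.vThree).adicCompletion ℚ) ((vThreeSeven K).adicCompletion (maximalRealSubfield K))).toAddMonoidHom)
        (Valued.v : Valuation ((vThreeSeven K).adicCompletion (maximalRealSubfield K)) (WithZero (Multiplicative ℤ))) = 0) ∧
    ∀ (ψ : AddChar ((T5InertPrimeToy.vThree).adicCompletion ℚ) Circle), Continuous ψ → (∃ y, ψ y ≠ 1) →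
      conductorExp ψ (Valued.v : Valuation ((T5InertPrimeToy.vThree).adicCompletion ℚ) (WithZero (Multiplicative ℤ))) = 0 →
      ∀ (w : HeightOneSpectrum (𝓞 K)) [w.asIdeal.LiesOver (vThreeSeven K).asIdeal],
        (vThreeSeven K).asIdeal.ramificationIdx' w.asIdeal = 1 ∧
        conductorExp (recordChar K (T5InertPrimeToy.vThree) (vThreeSeven K) w ψ)
          (Valued.v : Valuation (w.adicCompletion K) (WithZero (Multiplicative ℤ))) = 0 ∧
        (∀ x : w.adicCompletion K,
          (∀ y : w.adicCompletion K, Valued.v y ≤ 1 → recordChar K (T5InertPrimeToy.vThree) (vThreeSeven K) w ψ (x * y) = 1) ↔ Valued.v x ≤ 1) ∧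
        (∀ [StarRing (w.adicCompletion K)],
          (∀ z : w.adicCompletion K, IsLocalization.IsInteger (w.adicCompletionIntegers K) z →
            IsLocalization.IsInteger (w.adicCompletionIntegers K) (star z)) →
          ∀ x : Fin 3 → w.adicCompletion K,
            (∀ y ∈ stdLattice (w.adicCompletionIntegers K),
              recordChar K (T5InertPrimeToy.vThree) (vThreeSeven K) w ψ
                (sesqForm (((algebraMap (𝓞 K) K).mapMatrix (Matrix.diagonal ![1, 1, -1])).map (algebraMap K (w.adicCompletion K))) x y) = 1) ↔
              x ∈ stdLattice (w.adicCompletionIntegers K)) ∧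
        (letI := swapStarRing (w.adicCompletion K)
          ∀ x : Fin 3 → w.adicCompletion K × w.adicCompletion K,
            (∀ y : Fin 3 → w.adicCompletion K × w.adicCompletion K,
              (∀ i, Valued.v (y i).1 ≤ 1 ∧ Valued.v (y i).2 ≤ 1) →
              recordChar K (T5InertPrimeToy.vThree) (vThreeSeven K) w ψ
                  (sesqForm (pairMatrix (((algebraMap (𝓞 K) K).mapMatrix (Matrix.diagonal ![1, 1, -1])).map (algebraMap K (w.adicCompletion K)))
                    (((algebraMap (𝓞 K) K).mapMatrix (Matrix.diagonal ![1, 1, -1])).map (algebraMap K (w.adicCompletion K)))ᵀ) x y).1 *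
                recordChar K (T5InertPrimeToy.vThree) (vThreeSeven K) w ψ
                  (sesqForm (pairMatrix (((algebraMap (𝓞 K) K).mapMatrix (Matrix.diagonal ![1, 1, -1])).map (algebraMap K (w.adicCompletion K)))
                    (((algebraMap (𝓞 K) K).mapMatrix (Matrix.diagonal ![1, 1, -1])).map (algebraMap K (w.adicCompletion K)))ᵀ) x y).2 = 1) ↔
              ∀ i, Valued.v (x i).1 ≤ 1 ∧ Valued.v (x i).2 ≤ 1) :=
  record_lattice_model_seven_three K (Matrix.diagonal ![1, 1, -1]) (isUnit_det_diagonal K)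

end Seven

section Four

variable (L : Type*) [Field L] [CharZero L] [IsCyclotomicExtension {2 ^ 2} ℚ L] [NumberField L]
variable {ι : Type*} [Fintype ι] [DecidableEq ι]

/-- `disc ℚ(i) = −4 ∉ v` at every place `v` of `ℚ(i)⁺` with `2 ∉ v` (`−4 ∈ v` would give `2 · 2 ∈ v`, so `2 ∈ v`). -/
theorem discr_four_notMem (v : HeightOneSpectrum (𝓞 (maximalRealSubfield L)))
    (h2 : (2 : 𝓞 (maximalRealSubfield L)) ∉ v.asIdeal) :
    ((discr L : ℤ) : 𝓞 (maximalRealSubfield L)) ∉ v.asIdeal := by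
  have hd : discr L = -4 := discr_four L
  rw [hd]
  intro h
  have h4 : (2 : 𝓞 (maximalRealSubfield L)) * 2 ∈ v.asIdeal := by
    have h' := v.asIdeal.neg_mem_iff.mpr h
    norm_num at h'
    have e : (2 : 𝓞 (maximalRealSubfield L)) * 2 = 4 := by norm_num
    rw [e]
    exact h'
  rcases v.isPrime.mem_or_mem h4 with h2' | h2'
  · exact h2 h2'
  · exact h2 h2'

/-- **THE LATTICE-MODEL DATA OF THE RECORD ON `ℚ(i)` AT EVERY PLACE WITH `2 ∉ v`** (file 331 with
`disc ℚ(i) = −4`). -/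
theorem record_lattice_model_four_outside_two (M : Matrix ι ι (𝓞 L)) (hM : IsUnit M.det)
    (vp : HeightOneSpectrum (𝓞 ℚ)) (v : HeightOneSpectrum (𝓞 (maximalRealSubfield L)))
    [v.asIdeal.LiesOver vp.asIdeal] (h2 : (2 : 𝓞 (maximalRealSubfield L)) ∉ v.asIdeal) :
    (∃ ψ : AddChar (vp.adicCompletion ℚ) Circle, Continuous ψ ∧ (∃ y, ψ y ≠ 1) ∧
      conductorExp ψ (Valued.v : Valuation (vp.adicCompletion ℚ) (WithZero (Multiplicative ℤ))) = 0 ∧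
      conductorExp (ψ.compAddMonoidHom
        (Algebra.trace (vp.adicCompletion ℚ) (v.adicCompletion (maximalRealSubfield L))).toAddMonoidHom)
        (Valued.v : Valuation (v.adicCompletion (maximalRealSubfield L)) (WithZero (Multiplicative ℤ))) = 0) ∧
    ∀ (ψ : AddChar (vp.adicCompletion ℚ) Circle), Continuous ψ → (∃ y, ψ y ≠ 1) →
      conductorExp ψ (Valued.v : Valuation (vp.adicCompletion ℚ) (WithZero (Multiplicative ℤ))) = 0 →
      ∀ (w : HeightOneSpectrum (𝓞 L)) [w.asIdeal.LiesOver v.asIdeal],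
        v.asIdeal.ramificationIdx' w.asIdeal = 1 ∧
        conductorExp (recordChar L vp v w ψ)
          (Valued.v : Valuation (w.adicCompletion L) (WithZero (Multiplicative ℤ))) = 0 ∧
        (∀ x : w.adicCompletion L,
          (∀ y : w.adicCompletion L, Valued.v y ≤ 1 → recordChar L vp v w ψ (x * y) = 1) ↔ Valued.v x ≤ 1) ∧
        (∀ [StarRing (w.adicCompletion L)],
          (∀ z : w.adicCompletion L, IsLocalization.IsInteger (w.adicCompletionIntegers L) z →
            IsLocalization.IsInteger (w.adicCompletionIntegers L) (star z)) →
          ∀ x : ι → w.adicCompletion L,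
            (∀ y ∈ stdLattice (w.adicCompletionIntegers L),
              recordChar L vp v w ψ
                (sesqForm (((algebraMap (𝓞 L) L).mapMatrix M).map (algebraMap L (w.adicCompletion L))) x y) = 1) ↔
              x ∈ stdLattice (w.adicCompletionIntegers L)) ∧
        (letI := swapStarRing (w.adicCompletion L)
          ∀ x : ι → w.adicCompletion L × w.adicCompletion L,
            (∀ y : ι → w.adicCompletion L × w.adicCompletion L,
              (∀ i, Valued.v (y i).1 ≤ 1 ∧ Valued.v (y i).2 ≤ 1) →
              recordChar L vp v w ψ
                  (sesqForm (pairMatrix (((algebraMap (𝓞 L) L).mapMatrix M).map (algebraMap L (w.adicCompletion L)))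
                    (((algebraMap (𝓞 L) L).mapMatrix M).map (algebraMap L (w.adicCompletion L)))ᵀ) x y).1 *
                recordChar L vp v w ψ
                  (sesqForm (pairMatrix (((algebraMap (𝓞 L) L).mapMatrix M).map (algebraMap L (w.adicCompletion L)))
                    (((algebraMap (𝓞 L) L).mapMatrix M).map (algebraMap L (w.adicCompletion L)))ᵀ) x y).2 = 1) ↔
              ∀ i, Valued.v (x i).1 ≤ 1 ∧ Valued.v (x i).2 ≤ 1) :=
  record_lattice_model_outside_discriminant L M hM v (discr_four_notMem L v h2) vp

omit [NumberField L] in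
/-- `2 ∉ vThreePlus`: with `3 ∈ vThreePlus`, `2 ∈ vThreePlus` would give `1 = 3 − 2 ∈ vThreePlus`. -/
theorem two_notMem_vThreePlus : (2 : 𝓞 (maximalRealSubfield L)) ∉ (vThreePlus L).asIdeal := by
  intro h2
  have h1 : (1 : 𝓞 (maximalRealSubfield L)) ∈ (vThreePlus L).asIdeal := by
    have h := Ideal.sub_mem _ (three_mem_vThreePlus L) h2
    norm_num at h
    exact h
  exact (vThreePlus L).isPrime.ne_top ((Ideal.eq_top_iff_one _).mpr h1)

omit [NumberField L] in
/-- The place `(3)` of `ℚ(i)⁺` (file 238's `vThreePlus`) lies over the place `(3)` of `ℚ`. -/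
instance liesOver_vThreePlus_vThree : (vThreePlus L).asIdeal.LiesOver T5InertPrimeToy.vThree.asIdeal := by
  refine ⟨?_⟩
  have hle : T5InertPrimeToy.vThree.asIdeal ≤ (vThreePlus L).asIdeal.under (𝓞 ℚ) := by
    show Ideal.span {3} ≤ _
    rw [Ideal.span_le, Set.singleton_subset_iff, SetLike.mem_coe, Ideal.mem_under, map_ofNat]
    exact three_mem_vThreePlus L
  exact (T5InertPrimeToy.vThree.isPrime.isMaximal T5InertPrimeToy.vThree.ne_bot).eq_of_le
    (Ideal.IsPrime.comap _).ne_top hle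

/-- **THE LATTICE-MODEL DATA ON `ℚ(i)` AT THE INERT PLACE `(3)`** (the place of files 238 / 345, `N(v) = 3`):
file 331's four clauses with `vp = (3)`, `v = vThreePlus`, for every `M ∈ GL(𝓞_{ℚ(i)})`. -/
theorem record_lattice_model_four_three (M : Matrix ι ι (𝓞 L)) (hM : IsUnit M.det) :
    (∃ ψ : AddChar ((T5InertPrimeToy.vThree).adicCompletion ℚ) Circle, Continuous ψ ∧ (∃ y, ψ y ≠ 1) ∧
      conductorExp ψ (Valued.v : Valuation ((T5InertPrimeToy.vThree).adicCompletion ℚ) (WithZero (Multiplicative ℤ))) = 0 ∧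
      conductorExp (ψ.compAddMonoidHom
        (Algebra.trace ((T5InertPrimeToy.vThree).adicCompletion ℚ) ((vThreePlus L).adicCompletion (maximalRealSubfield L))).toAddMonoidHom)
        (Valued.v : Valuation ((vThreePlus L).adicCompletion (maximalRealSubfield L)) (WithZero (Multiplicative ℤ))) = 0) ∧
    ∀ (ψ : AddChar ((T5InertPrimeToy.vThree).adicCompletion ℚ) Circle), Continuous ψ → (∃ y, ψ y ≠ 1) →
      conductorExp ψ (Valued.v : Valuation ((T5InertPrimeToy.vThree).adicCompletion ℚ) (WithZero (Multiplicative ℤ))) = 0 →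
      ∀ (w : HeightOneSpectrum (𝓞 L)) [w.asIdeal.LiesOver (vThreePlus L).asIdeal],
        (vThreePlus L).asIdeal.ramificationIdx' w.asIdeal = 1 ∧
        conductorExp (recordChar L (T5InertPrimeToy.vThree) (vThreePlus L) w ψ)
          (Valued.v : Valuation (w.adicCompletion L) (WithZero (Multiplicative ℤ))) = 0 ∧
        (∀ x : w.adicCompletion L,
          (∀ y : w.adicCompletion L, Valued.v y ≤ 1 → recordChar L (T5InertPrimeToy.vThree) (vThreePlus L) w ψ (x * y) = 1) ↔ Valued.v x ≤ 1) ∧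
        (∀ [StarRing (w.adicCompletion L)],
          (∀ z : w.adicCompletion L, IsLocalization.IsInteger (w.adicCompletionIntegers L) z →
            IsLocalization.IsInteger (w.adicCompletionIntegers L) (star z)) →
          ∀ x : ι → w.adicCompletion L,
            (∀ y ∈ stdLattice (w.adicCompletionIntegers L),
              recordChar L (T5InertPrimeToy.vThree) (vThreePlus L) w ψ
                (sesqForm (((algebraMap (𝓞 L) L).mapMatrix M).map (algebraMap L (w.adicCompletion L))) x y) = 1) ↔
              x ∈ stdLattice (w.adicCompletionIntegers L)) ∧
        (letI := swapStarRing (w.adicCompletion L)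
          ∀ x : ι → w.adicCompletion L × w.adicCompletion L,
            (∀ y : ι → w.adicCompletion L × w.adicCompletion L,
              (∀ i, Valued.v (y i).1 ≤ 1 ∧ Valued.v (y i).2 ≤ 1) →
              recordChar L (T5InertPrimeToy.vThree) (vThreePlus L) w ψ
                  (sesqForm (pairMatrix (((algebraMap (𝓞 L) L).mapMatrix M).map (algebraMap L (w.adicCompletion L)))
                    (((algebraMap (𝓞 L) L).mapMatrix M).map (algebraMap L (w.adicCompletion L)))ᵀ) x y).1 *
                recordChar L (T5InertPrimeToy.vThree) (vThreePlus L) w ψ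
                  (sesqForm (pairMatrix (((algebraMap (𝓞 L) L).mapMatrix M).map (algebraMap L (w.adicCompletion L)))
                    (((algebraMap (𝓞 L) L).mapMatrix M).map (algebraMap L (w.adicCompletion L)))ᵀ) x y).2 = 1) ↔
              ∀ i, Valued.v (x i).1 ≤ 1 ∧ Valued.v (x i).2 ≤ 1) :=
  record_lattice_model_four_outside_two L M hM T5InertPrimeToy.vThree (vThreePlus L) (two_notMem_vThreePlus L)

end Four

end Summit.Ventures.HodgeRepro2.T5RecordLatticeModelSeven
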